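import Literature.MathematicalPhysics.QuantumFieldTheory.BalabanImbrieJaffe1984to88.BIJ88Conditioning512
import Literature.MathematicalPhysics.QuantumFieldTheory.BalabanImbrieJaffe1984to88.BIJ88Normalization46

/-!
# `BalabanImbrieJaffe1984to88.BIJ88ExteriorForms5121` — T. Bałaban, J. Imbrie, A. Jaffe, *Effective action and cluster
properties of the abelian Higgs model*, Commun. Math. Phys. **114** (1988) 257–315 [BalabanImbrieJaffe1988], §5.12
*Conditional Integration*, pp. 301–302: the "exterior" Gaussian piece **(5.12.1)** (its third, fourth and fifth quadratic forms
and the factors `Z^{(k)}_{Λ^{(k)c*c}_{10}} Z^{(k)}_{Λ^{(k)}_{10}}(u_{k+1})`), the "interior" integral **(5.12.2)** with its `𝒩`, the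
gauge-field Gaussian **(5.12.3)** and the linear form **(5.12.5)** — the printed *calculations leading to (5.12.1)* PROVED on the
finite-dimensional Gaussian model the print describes

statement-level skeleton of published theorems with citation tags; proofs where landed; nothing here is a claim about the Yang–Mills mass gap

PDF held: `paper:balaban1988-cmp114-bij-abelian-higgs-effective-action` (journal page = PDF page + 256).  Renders read this
session as images: p. 301 = PDF 45, p. 302 = PDF 46 (`HOME/lit-balaban-p02/pages/original-p045-x2.png`, `-p046-x2.png`).

CITATION HEADER (lean-in-tree rule).  Part of the lit-balaban TYPED SKELETON (HOME `run/shared/lean/pub/lit-balaban/`), row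
**C2.Eq5.12.1-5.12.7** (`HOME/lit-balaban-r16/ROWS-C2-part2.md`, fold owner r16), whose cell recorded *"(5.12.1)–(5.12.3), (5.12.5)
… still absent"* after p10's `BIJ88Conditioning512` (the p. 300 conditioning identity for scalar fields, `display300`, `calN_eq`)
and p02 gen 4's `BIJ88LocTransl5126` ((5.12.4) and the `δ`-function sentence; (5.12.6)–(5.12.7) exponent).  This file is the
missing middle: it is built BY NAME on `BIJ88Conditioning512` and on the tree's `B2Eq228Conditioning.integral_tilt` (the linear
shift = translation invariance of Lebesgue measure); nothing of those files is restated.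

**What the paper prints (verbatim, p. 301 [PDF 45] – p. 302 [PDF 46]).**  *"Thus in our expression for ρ^L_{k+1}(v,ψ), we have
now an "exterior" integral over u^{(k)}, φ^{(k)} in Λ^{(k)c}_{10}, whose Gaussian piece has been replaced by
  δ_{Ax,Λ^{(k)′c}_{10}}(u^{(k)}) δ_{Λ^{(k)′*}_1∩Λ^{(k)′c*}_{10}}((e_k/2π)QA^{(k)})
  × exp[−½⟨Λ^{(k)**}_1∂Λ^{(k)c*}_{10}A^{(k)}, σ_{k,loc}Λ^{(k)**}_1∂Λ^{(k)c}_{10}A^{(k)}⟩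
   −½⟨(Λ^{(k−1)′}_8∩Λ^{(k)c}_{10})φ^{(k)}, (Δ_{k,loc}(ũ_{k+1}) + aL^{−2}P(ũ_{k+1}))(Λ^{(k−1)′}_8∩Λ^{(k)c}_{10})φ^{(k)}⟩
   +½⟨Λ^{(k)c}_{10}φ^{(k)}, Δ_{k,loc}(u_{k+1})C^{(k)}_{Λ^{(k)}_{10}}(u_{k+1})Δ_{k,loc}(u_{k+1})Λ^{(k)c}_{10}φ^{(k)}⟩
   −½⟨Λ^{(k)c*}_{10}A^{(k)}, L^{−1}Q*Q^sΛ^{(k)c*c}_{10}∂*σ_{k,loc}∂(L^{−1}Λ^{(k)c*c}_{10}Q^{s*}Q − 2)Λ^{(k)c*}_{10}A^{(k)}⟩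
   +½⟨Λ^{(k)c*}_{10}A^{(k)}, (I − L^{−1}Q*Q^sΛ^{(k)c*c}_{10})∂*σ_{k,loc}∂C^{(k)}_{Λ^{(k)c*c}_{10}}∂*σ_{k,loc}∂
      × (I − L^{−1}Λ^{(k)c*c}_{10}Q^{s*}Q)Λ^{(k)c*}_{10}A^{(k)}⟩] Z^{(k)}_{Λ^{(k)c*c}_{10}} Z^{(k)}_{Λ^{(k)}_{10}}(u_{k+1}).   (5.12.1)
The "interior" integral is
  (1/𝒩)∫dφ^{(k)}|_{Λ^{(k)}_{10}} dA^{(k)}|_{Λ^{(k)c*c}_{10}} δ_{Ax,Λ^{(k)′}_{10}}(A^{(k)}) δ_{Λ^{(k)′c*c}_{10}}(QA^{(k)}) χ′_{Λ^{(k)}_7}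
  Π_{σ₁∈σ̃₁}F^{m̄}_{k,loc}(X_{σ₁}) × exp[−½⟨Λ^{(k)}_{10}φ^{(k)}, (Δ_{k,loc}(u_{k+1}) + aL^{−2}P(u_{k+1}))(Λ^{(k)}_{10} + 2Λ^{(k)c}_{10})φ^{(k)}⟩
  −½⟨Λ^{(k)c*c}_{10}A^{(k)}, ∂*σ_{k,loc}∂(Λ^{(k)c*c}_{10} + 2Λ^{(k)c*}_{10})A^{(k)}⟩ − V^{(k)}(Λ^{(k)}_8, u_{k+1}, A^{(k)}, φ^{(k)})].   (5.12.2)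
Here 𝒩 is defined by the last integral, but without χ′_{Λ^{(k)}_7}, F^{m̄}_{k,loc}, or V^{(k)}.  Let us describe more carefully the
calculations leading to (5.12.1).  The third form, together with Z^{(k)}_{Λ^{(k)}_{10}}(u_{k+1}), is a calculation of
  ∫dφ^{(k)}|_{Λ^{(k)}_{10}} exp[−½⟨Λ^{(k)}_{10}φ^{(k)}, (Δ_{k,loc}(u_{k+1}) + aL^{−2}P(u_{k+1}))(Λ^{(k)}_{10} + 2Λ^{(k)c}_{10})φ^{(k)}⟩].
The 4-th and 5-th forms, with Z^{(k)}_{Λ^{(k)c*c}_{10}}, are a calculation of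
  ∫dA^{(k)}|_{Λ^{(k)c*c}_{10}} δ_{Ax,Λ^{(k)′}_{10}}(A^{(k)}) δ_{Λ^{(k)′c*c}_{10}}(QA^{(k)}) (e_k/2π)^{‖Λ^{(k)c*c}_{10}‖}
  × exp[−½⟨Λ^{(k)c*c}_{10}A^{(k)}, ∂*σ_{k,loc}∂(Λ^{(k)c*c}_{10} + 2Λ^{(k)c*}_{10})A^{(k)}⟩].   (5.12.3)
The factors e_k/2π come from the replacement of du^{(k)} with dA^{(k)} for the free variables; for the constrained variables the
replacement is compensated by a removal of the e_k/2π factor from the δ-functions, see (4.6)–(4.8).  We calculate (5.12.3) by means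
of a translation A^{(k)} = A^{(k)′} − Λ^{(k)c*c}_{10}Q^{s*}QΛ^{(k)c*}_{10}A^{(k)}, (5.12.4) … The fourth quadratic form above is obtained
by collecting the terms in the exponential quadratic in Λ^{(k)c*}_{10}A^{(k)}.  There remains a linear form
  ⟨Λ^{(k)c*c}_{10}A^{(k)′}, ∂*σ_{k,loc}∂(I − Λ^{(k)c*c}_{10}Q^{s*}Q)Λ^{(k)c*}_{10}A^{(k)}⟩,   (5.12.5)
whose expectation in the Gaussian exp(−½⟨Λ^{(k)c*c}_{10}A^{(k)′}, ∂*σ_{k,loc}∂Λ^{(k)c*c}_{10}A^{(k)′}⟩) gives rise to the fifth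
form."*

**The model (finite-dimensional, exactly the printed generality; vocabulary = the tree's `B2Eq228Conditioning`, as in
`BIJ88Conditioning512`).**  A finite index type `S` (the sites of the scalar sector in real coordinates, resp. the bonds of the
gauge sector) split by a decidable predicate `p` into the INTEGRATED part `In p` (`Λ^{(k)}_{10}`, resp. `Λ^{(k)c*c}_{10}`) and the
EXTERIOR part `Out p` (`Λ^{(k)c}_{10}`, resp. `Λ^{(k)c*}_{10}`); the characteristic functions `Λφ`, `Λᶜφ` are `chiIn`/`chiOut`
(extension by zero); the quadratic forms are real symmetric matrices on `S`: `Δ` = `Δ_{k,loc}(u_{k+1})`, `P` = `aL^{−2}P(u_{k+1})`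
with NO `Λ^{(k)}_{10} × Λ^{(k)c}_{10}` block (`blkMix p P = 0`: `P(u) = Q(u)*Q(u)` acts within `L`-blocks and `Λ^{(k)}_{10}` is a
union of blocks — declared reading of why the third form carries `Δ_{k,loc}` alone), `T` = `∂*σ_{k,loc}∂`.  Gauge sector: the
`δ`-functions of (5.12.3) are read as the print reads them via (4.6)–(4.8) — *"‖Λ^{(k)c*c}_{10}‖ is the number of free integrations
after enforcing the δ-functions"*: after the translation (5.12.4) (`R : Matrix (In p) (Out p) ℝ` = `Λ^{c*c}Q^{s*}QΛ^{c*}`, a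
particular solution of the block-average constraint, `BIJ88LocTransl5126.eq5124_delta`) the constraint set is a LINEAR subspace
`K` of the interior configurations, parametrized by free coordinates `x : ι → ℝ` through `E : Matrix (In p) ι ℝ`
(`Λ^{(k)c*c}_{10}A^{(k)′} = Ex`); the factors `(e_k/2π)^{‖Λ‖}` and the constants `E^{(j)}` of (4.6)/(4.9) are dropped (they are
bookkept in `BIJ88Normalization46`; `Z49_eq_Zscalar` below is the dictionary).

**What is kernel-checked (zero `sorry`, standard axioms, no new named facts).**
 §1 `form_in_two_out`: the printed shape `⟨Λφ, M(Λ + 2Λᶜ)φ⟩ = ⟨φ_Λ, M_Λφ_Λ⟩ + 2⟨φ_{Λᶜ}, M_{ΛᶜΛ}φ_Λ⟩` (symmetric `M`).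
 §2 SCALAR SECTOR.  `thirdForm` = *"+½⟨Λ^{(k)c}_{10}φ, Δ_{k,loc}C^{(k)}_{Λ_{10}}(u_{k+1})Δ_{k,loc}Λ^{(k)c}_{10}φ⟩"* with
    `C^{(k)}_{Λ_{10}}(u_{k+1}) := (blkIn p (Δ + P))⁻¹` (the Dirichlet inverse (2.39)–(2.40)); `Zscalar` = `Z^{(k)}_{Λ_{10}}(u_{k+1})`
    without its constant (`Z49_eq_Zscalar`: r18's (4.9) `Z49 = e^{−E|Λ|}·Zscalar`); **`thirdForm_calc`** = the sentence *"The third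
    form, together with Z_{Λ_{10}}(u_{k+1}), is a calculation of ∫dφ|_{Λ_{10}} exp[−½⟨Λ_{10}φ,(Δ+aL⁻²P)(Λ_{10}+2Λᶜ_{10})φ⟩]"*:
    that integral EQUALS `Zscalar · e^{thirdForm}`; `calN_eq_thirdForm` (the same for p10's `𝒩`); **`eq5121_5122_scalar`** =
    (5.12.1) × (5.12.2) for the scalar sector with `G = χ′ΠF e^{−V}` arbitrary (p10's `display300`, renamed into the print's
    factors: exterior `e^{thirdForm}`, `Z`, and `𝒩⁻¹ × interior integral`).
 §3 GAUGE SECTOR.  `expo523` = the exponent of (5.12.3) (`expo523_eq_printed`); `fourthForm` (`fourthForm_eq_printed`: the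
    printed `−½⟨Λ^{c*}A, R†∂*σ∂(R − 2)Λ^{c*}A⟩` with the adjoint written on the left); `linForm5125` = the vector
    `∂*σ_{k,loc}∂(I − Λ^{c*c}Q^{s*}Q)Λ^{c*}A` paired in (5.12.5); **`expo523_transl`** = the sentence *"The fourth quadratic form above
    is obtained by collecting the terms … quadratic in Λ^{c*}A. There remains a linear form (5.12.5)"*: under (5.12.4),
    `expo523(A′ − RA_e, A_e) = −½⟨A′, TA′⟩ − (5.12.5) + fourthForm(A_e)` EXACTLY; `constrInt523` = (5.12.3) in free coordinates and
    `constrInt523_indep` (another particular solution of the constraints differing by an element of `K` gives the same integral —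
    translation invariance); `fifthForm` = *"+½⟨Λ^{c*}A,(I−R)†∂*σ∂ C_{Λ^{c*c}} ∂*σ∂(I−R)Λ^{c*}A⟩"* with `C_{Λ^{c*c}} := covK =
    E(EᵀTE)⁻¹Eᵀ` the covariance of the constrained Gaussian; **`eq5123_calc`** = the sentence *"The 4-th and 5-th forms, with
    Z_{Λ^{c*c}}, are a calculation of (5.12.3)"*: `constrInt523 = Zgauge · e^{fourthForm + fifthForm}`; **`expect_linForm5125`** = the
    sentence *"whose expectation in the Gaussian exp(−½⟨Λ^{c*c}A′,∂*σ∂Λ^{c*c}A′⟩) gives rise to the fifth form"*.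
 §4 (v1.1) p. 302 *"Altogether the exponential in (5.12.1) has been written as exp[−𝒬₇ − 𝒬₈ − Σ_X W₅^{(k)}(X)]"*:
    `halfQuad` (third/fifth form as a function of the covariance), `halfQuad_decomp` (linearity under `C = C_loc + Σ_X C_X`, the
    random-walk expansions (2.45)/(2.48) as data), `Q8`, `W5`, **`exponent5121_regroup`** / `exp_exponent5121_regroup` (the
    regrouping identity; the bound `|W₅(X)| ≤ e^{−cr(e_k)|X|}` is NOT claimed).
**Readings (declared).**  (i) real coordinates and real symmetric matrices for the printed operators; (ii) `blkMix p P = 0`;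
(iii) the print's `L^{−1}` in front of `Λ^{c*c}Q^{s*}Q` in (5.12.1)/(5.12.6) but not in (5.12.4)/(5.12.5) is carried by the
free parameter `R` (any particular-solution map; the identities hold for every `R`), not adjudicated; (iv) δ-functions = linear
parametrization `E` of the constraint subspace, constants dropped.  **Not claimed.**  The random-walk localizations
`C_{loc}`/`W₅^{(k)}` of p. 302, the bound `|W₅^{(k)}(X)| ≤ e^{−cr(e_k)|X|}`, the measure (5.12.7) and (5.12.8); anything of B1–B16.
NOT summit progress; NOT continuum; NOT Clay.  Imports Literature only; no Summits import; modifies nothing.  Cell `lit-balaban`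
Phase 2, seat p02 gen 6.
-/

open MeasureTheory Matrix Finset
open scoped BigOperators

namespace Literature.MathematicalPhysics.QuantumFieldTheory.BalabanImbrieJaffe1984to88.BIJ88ExteriorForms5121

open Balaban1983to89.B2Eq228Conditioning
open Balaban1983to89.B13GaugeDevices (gaussWeight gaussInt gaussNorm gaussMean gaussInt_one_eq_gaussNorm)
open BIJ88Conditioning512

noncomputable section

variable {S : Type} [Fintype S] (p : S → Prop) [DecidablePred p]

/-! ## §1 Characteristic functions and the printed shape `⟨Λφ, M(Λ + 2Λᶜ)φ⟩` -/

/-- `Λφ`: the field cut off to the integrated region (extended by zero outside), as a function of `φ|_Λ`.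
[cite: BalabanImbrieJaffe1988, (5.12.2) p.301] -/
def chiIn (x : In p → ℝ) : S → ℝ := glue p x 0

/-- `Λᶜφ`: the field cut off to the exterior region, as a function of `φ|_{Λᶜ}`. [cite: BalabanImbrieJaffe1988, (5.12.2) p.301] -/
def chiOut (y : Out p → ℝ) : S → ℝ := glue p 0 y

/-- Bilinear block expansion of `⟨(x on Λ, y on Λᶜ), M(x′ on Λ, y′ on Λᶜ)⟩`.
[folklore] [cite: BalabanImbrieJaffe1988, (5.12.2) p.301] -/
private theorem bilin_glue (M : Matrix S S ℝ) (x x' : In p → ℝ) (y y' : Out p → ℝ) :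
    glue p x y ⬝ᵥ (M *ᵥ glue p x' y')
      = x ⬝ᵥ (blkIn p M *ᵥ x') + x ⬝ᵥ (blkMix p M *ᵥ y') + y ⬝ᵥ (blkMix' p M *ᵥ x') + y ⬝ᵥ (blkOut p M *ᵥ y') := by
  rw [dotProduct, sum_split p]
  simp only [glue_apply_in, glue_apply_out, mulVec_glue_in, mulVec_glue_out, mul_add, sum_add_distrib]
  simp only [dotProduct]
  ring

/-- **The printed shape of the exponents of (5.12.2)/(5.12.3)**: for symmetric `M`,
`⟨Λφ, M(Λ + 2Λᶜ)φ⟩ = ⟨φ|_Λ, M_Λ φ|_Λ⟩ + 2⟨φ|_{Λᶜ}, M_{ΛᶜΛ} φ|_Λ⟩` — the interior quadratic form plus twice the interior–exterior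
coupling (the exterior–exterior part is absent: it stays in the exterior integral). [cite: BalabanImbrieJaffe1988, (5.12.2) p.301] -/
theorem form_in_two_out (M : Matrix S S ℝ) (hM : M.IsSymm) (x : In p → ℝ) (y : Out p → ℝ) :
    chiIn p x ⬝ᵥ (M *ᵥ (chiIn p x + (2 : ℝ) • chiOut p y))
      = x ⬝ᵥ (blkIn p M *ᵥ x) + 2 * (y ⬝ᵥ (blkMix' p M *ᵥ x)) := by
  unfold chiIn chiOut
  rw [mulVec_add, mulVec_smul, dotProduct_add, dotProduct_smul, bilin_glue, bilin_glue]
  simp only [mulVec_zero, dotProduct_zero, zero_dotProduct, add_zero, zero_add, smul_eq_mul]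
  have hm : x ⬝ᵥ (blkMix p M *ᵥ y) = y ⬝ᵥ (blkMix' p M *ᵥ x) := by
    rw [mix_dot_eq p M hM x y]
    unfold srcJ
    exact dotProduct_comm _ _
  rw [hm]

/-! ## §2 The scalar sector: the third form of (5.12.1), `Z_{Λ₁₀}(u_{k+1})`, and `𝒩` of (5.12.2) -/

section Scalar

variable (Δ P : Matrix S S ℝ)

/-- **The third form of (5.12.1)**, *"+½⟨Λ^{(k)c}_{10}φ^{(k)}, Δ_{k,loc}(u_{k+1}) C^{(k)}_{Λ^{(k)}_{10}}(u_{k+1}) Δ_{k,loc}(u_{k+1})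
Λ^{(k)c}_{10}φ^{(k)}⟩"*, as a function of the exterior field `y = φ^{(k)}|_{Λ^{(k)c}_{10}}`: `Δ` the matrix of `Δ_{k,loc}(u_{k+1})`,
`M` that of `Δ_{k,loc}(u_{k+1}) + aL^{−2}P(u_{k+1})`, `C^{(k)}_{Λ_{10}}(u_{k+1}) := (M_Λ)⁻¹` its Dirichlet inverse on `Λ^{(k)}_{10}`.
[cite: BalabanImbrieJaffe1988, (5.12.1) p.301] -/
def thirdForm [DecidableEq S] (Δ M : Matrix S S ℝ) (y : Out p → ℝ) : ℝ :=
  (1 / 2 : ℝ) * ((blkMix p Δ *ᵥ y) ⬝ᵥ ((blkIn p M)⁻¹ *ᵥ (blkMix p Δ *ᵥ y)))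

/-- **`Z^{(k)}_{Λ^{(k)}_{10}}(u_{k+1})`** of (5.12.1) (= (4.9) without its constant `e^{−E|Λ_{10}|}`): `∫dφ|_{Λ_{10}} e^{−½⟨φ, M_Λφ⟩}`.
[cite: BalabanImbrieJaffe1988, (5.12.1) p.301] -/
def Zscalar (M : Matrix S S ℝ) : ℝ := gaussNorm (blkIn p M)

/-- `Z_{Λ_{10}}(u_{k+1}) > 0` for `M_Λ` positive definite. [cite: BalabanImbrieJaffe1988, (5.12.1) p.301] -/
theorem Zscalar_pos [DecidableEq S] (M : Matrix S S ℝ) (hM : (blkIn p M).PosDef) : 0 < Zscalar p M :=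
  gaussNorm_pos hM

/-- Dictionary to r18's typed (4.9): `BIJ88Normalization46.Z49 (M_Λ) E N = e^{−EN} · Zscalar`.
[cite: BalabanImbrieJaffe1988, (4.9) p.275] -/
theorem Z49_eq_Zscalar [DecidableEq S] (M : Matrix S S ℝ) (E N : ℝ) :
    BIJ88Normalization46.Z49 (blkIn p M) E N = Real.exp (-(E * N)) * Zscalar p M := by
  unfold BIJ88Normalization46.Z49 Zscalar gaussNorm
  simp_rw [gaussWeight_eq]

omit [Fintype S] [DecidablePred p] in
/-- With no `Λ_{10} × Λ^c_{10}` block in `P` (*"P(u) = Q(u)*Q(u)"*, (4.10), is block-local), the source the exterior field induces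
on `Λ_{10}` through `Δ + P` is `ΛΔΛᶜφ` — the reason the third form of (5.12.1) carries `Δ_{k,loc}(u_{k+1})` alone.
[cite: BalabanImbrieJaffe1988, (5.12.1) p.301] -/
theorem blkMix_add_of_blockLocal (hP : blkMix p P = 0) : blkMix p (Δ + P) = blkMix p Δ := by
  have h : blkMix p (Δ + P) = blkMix p Δ + blkMix p P := by
    ext i j
    rfl
  rw [h, hP, add_zero]

/-- The integrand of the print's *"∫dφ|_{Λ_{10}} exp[−½⟨Λ_{10}φ, M(Λ_{10} + 2Λ^c_{10})φ⟩]"* is p10's `e^{−½⟨φ,M_Λφ⟩}e^{−⟨Λᶜφ,MΛφ⟩}`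
(`wIn · cpl` of `BIJ88Conditioning512`). [cite: BalabanImbrieJaffe1988, (5.12.2) p.301] -/
theorem integrand_eq_wIn_cpl (M : Matrix S S ℝ) (hM : M.IsSymm) (x : In p → ℝ) (y : Out p → ℝ) :
    Real.exp (-(1 / 2 : ℝ) * (chiIn p x ⬝ᵥ (M *ᵥ (chiIn p x + (2 : ℝ) • chiOut p y))))
      = wIn p M x * cpl p M x y := by
  rw [form_in_two_out p M hM x y, wIn, cpl, ← Real.exp_add]
  congr 1
  ring

/-- **p. 301, verbatim: *"The third form, together with Z^{(k)}_{Λ^{(k)}_{10}}(u_{k+1}), is a calculation of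
∫dφ^{(k)}|_{Λ^{(k)}_{10}} exp[−½⟨Λ^{(k)}_{10}φ^{(k)}, (Δ_{k,loc}(u_{k+1}) + aL^{−2}P(u_{k+1}))(Λ^{(k)}_{10} + 2Λ^{(k)c}_{10})φ^{(k)}⟩]"***
— PROVED: for `Δ + P` symmetric with positive definite `Λ_{10}`-block and `P` block-local, that integral (Lebesgue `dφ|_{Λ_{10}}`,
exterior field `y` fixed) EQUALS `Z_{Λ_{10}}(u_{k+1}) · exp(+½⟨Λᶜφ, Δ C_{Λ_{10}}(u_{k+1}) Δ Λᶜφ⟩)` (translation invariance of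
`dφ|_Λ`: `BIJ88Conditioning512.calN_eq`). [cite: BalabanImbrieJaffe1988, (5.12.1) p.301] -/
theorem thirdForm_calc [DecidableEq S] (hM : (Δ + P).IsSymm) (hpos : (blkIn p (Δ + P)).PosDef) (hP : blkMix p P = 0)
    (y : Out p → ℝ) :
    ∫ x, Real.exp (-(1 / 2 : ℝ) * (chiIn p x ⬝ᵥ ((Δ + P) *ᵥ (chiIn p x + (2 : ℝ) • chiOut p y))))
      = Zscalar p (Δ + P) * Real.exp (thirdForm p Δ (Δ + P) y) := by
  simp_rw [integrand_eq_wIn_cpl p (Δ + P) hM]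
  have h2 : (∫ x, wIn p (Δ + P) x * cpl p (Δ + P) x y) = calN p (Δ + P) y := rfl
  rw [h2, calN_eq p (Δ + P) hM hpos y]
  unfold srcJ Zscalar thirdForm
  rw [blkMix_add_of_blockLocal p Δ P hP]

/-- **𝒩 of (5.12.2) for the scalar sector** (*"Here 𝒩 is defined by the last integral, but without χ′, F^{m̄}, or V"*, i.e.
p10's `calN`): `𝒩(φ|_{Λᶜ}) = Z_{Λ_{10}}(u_{k+1}) · e^{thirdForm}`. [cite: BalabanImbrieJaffe1988, (5.12.2) p.301] -/
theorem calN_eq_thirdForm [DecidableEq S] (hM : (Δ + P).IsSymm) (hpos : (blkIn p (Δ + P)).PosDef) (hP : blkMix p P = 0)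
    (y : Out p → ℝ) :
    calN p (Δ + P) y = Zscalar p (Δ + P) * Real.exp (thirdForm p Δ (Δ + P) y) := by
  rw [← thirdForm_calc p Δ P hM hpos hP y]
  simp_rw [integrand_eq_wIn_cpl p (Δ + P) hM]
  rfl

/-- **(5.12.1) × (5.12.2), scalar sector** (the p. 300 conditioning identity `BIJ88Conditioning512.display300` read with the
names of p. 301): for EVERY exterior factor `F(φ|_{Λᶜ})` and EVERY interior observable `G(φ)` (print: `G = χ′_{Λ_7} Π F^{m̄}_{k,loc}
e^{−V^{(k)}}`),
`∫dφ|_{Λᶜ} F ∫dφ|_Λ e^{−½⟨Λφ, M(Λ + 2Λᶜ)φ⟩} G = Z_{Λ_{10}}(u_{k+1}) ∫dφ|_{Λᶜ} F · e^{thirdForm} · (𝒩⁻¹ ∫dφ|_Λ G e^{−½⟨φ,M_Λφ⟩}e^{−⟨Λᶜφ,MΛφ⟩})`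
— the exterior Gaussian piece acquires the third form and the factor `Z_{Λ_{10}}(u_{k+1})` (5.12.1), the interior integral is
normalized by `𝒩` (5.12.2). [cite: BalabanImbrieJaffe1988, (5.12.1) p.301] -/
theorem eq5121_5122_scalar [DecidableEq S] (hM : (Δ + P).IsSymm) (hpos : (blkIn p (Δ + P)).PosDef) (hP : blkMix p P = 0)
    (F : (Out p → ℝ) → ℝ) (G : (S → ℝ) → ℝ) :
    ∫ y, F y * ∫ x, Real.exp (-(1 / 2 : ℝ) * (chiIn p x ⬝ᵥ ((Δ + P) *ᵥ (chiIn p x + (2 : ℝ) • chiOut p y)))) * G (glue p x y)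
      = Zscalar p (Δ + P)
        * ∫ y, F y * Real.exp (thirdForm p Δ (Δ + P) y) * ((calN p (Δ + P) y)⁻¹ * lastInt p (Δ + P) G y) := by
  have h1 : ∀ x y, Real.exp (-(1 / 2 : ℝ) * (chiIn p x ⬝ᵥ ((Δ + P) *ᵥ (chiIn p x + (2 : ℝ) • chiOut p y)))) * G (glue p x y)
      = cpl p (Δ + P) x y * wIn p (Δ + P) x * G (glue p x y) := by
    intro x y
    rw [integrand_eq_wIn_cpl p (Δ + P) hM, mul_comm (wIn p (Δ + P) x)]
  simp_rw [h1]
  rw [display300 p (Δ + P) hM hpos F G]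
  unfold Zscalar
  congr 1
  refine integral_congr_ae (Filter.Eventually.of_forall fun y => ?_)
  show F y * Real.exp (1 / 2 * (y ⬝ᵥ (blkMix' p (Δ + P) *ᵥ ((blkIn p (Δ + P))⁻¹ *ᵥ (blkMix p (Δ + P) *ᵥ y)))))
        * ((calN p (Δ + P) y)⁻¹ * lastInt p (Δ + P) G y)
      = F y * Real.exp (thirdForm p Δ (Δ + P) y) * ((calN p (Δ + P) y)⁻¹ * lastInt p (Δ + P) G y)
  rw [← exponent_eq_printed p (Δ + P) hM y]
  unfold srcJ thirdForm
  rw [blkMix_add_of_blockLocal p Δ P hP]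

end Scalar

/-! ## §3 The gauge sector: (5.12.3), the translation (5.12.4), the linear form (5.12.5), the fourth and fifth forms -/

section Gauge

variable (T : Matrix S S ℝ) (R : Matrix (In p) (Out p) ℝ)

/-- **The exponent of (5.12.3)**, `−½⟨Λ^{c*c}A, ∂*σ_{k,loc}∂(Λ^{c*c} + 2Λ^{c*})A⟩`, as a function of the interior bond variables
`a′ = Λ^{(k)c*c}_{10}A` and the exterior ones `a = Λ^{(k)c*}_{10}A` (`T` the matrix of `∂*σ_{k,loc}∂`; see `expo523_eq_printed`).
[cite: BalabanImbrieJaffe1988, (5.12.3) p.301] -/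
def expo523 (a' : In p → ℝ) (a : Out p → ℝ) : ℝ :=
  -(1 / 2 : ℝ) * (a' ⬝ᵥ (blkIn p T *ᵥ a')) - a ⬝ᵥ (blkMix' p T *ᵥ a')

/-- `expo523` IS the printed `−½⟨Λ^{c*c}A, ∂*σ_{k,loc}∂(Λ^{c*c} + 2Λ^{c*})A⟩` (symmetric `T`).
[cite: BalabanImbrieJaffe1988, (5.12.3) p.301] -/
theorem expo523_eq_printed (hT : T.IsSymm) (a' : In p → ℝ) (a : Out p → ℝ) :
    expo523 p T a' a = -(1 / 2 : ℝ) * (chiIn p a' ⬝ᵥ (T *ᵥ (chiIn p a' + (2 : ℝ) • chiOut p a))) := by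
  rw [form_in_two_out p T hT a' a, expo523]
  ring

/-- **The fourth form of (5.12.1)**, *"−½⟨Λ^{c*}A, L^{−1}Q*Q^sΛ^{c*c}∂*σ_{k,loc}∂(L^{−1}Λ^{c*c}Q^{s*}Q − 2)Λ^{c*}A⟩"*, with the adjoint
`(Λ^{c*c}Q^{s*}QΛ^{c*})† = Λ^{c*}Q*Q^sΛ^{c*c}` moved onto the left argument: `−½⟨Ra, T_{in}Ra⟩ + ⟨Ra, T_{mix}a⟩` (`R` the matrix of
the particular-solution map `Λ^{c*c}Q^{s*}QΛ^{c*}` of (5.12.4), with or without the print's `L^{−1}`). [cite: BalabanImbrieJaffe1988, (5.12.1) p.301] -/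
def fourthForm (a : Out p → ℝ) : ℝ :=
  -(1 / 2 : ℝ) * ((R *ᵥ a) ⬝ᵥ (blkIn p T *ᵥ (R *ᵥ a))) + (R *ᵥ a) ⬝ᵥ (blkMix p T *ᵥ a)

/-- `fourthForm` in the printed grouping `−½⟨Ra, ∂*σ∂(R − 2)Λ^{c*}A⟩`. [cite: BalabanImbrieJaffe1988, (5.12.1) p.301] -/
theorem fourthForm_eq_printed (a : Out p → ℝ) :
    fourthForm p T R a = -(1 / 2 : ℝ) * ((R *ᵥ a) ⬝ᵥ (blkIn p T *ᵥ (R *ᵥ a) - (2 : ℝ) • (blkMix p T *ᵥ a))) := by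
  rw [fourthForm, dotProduct_sub, dotProduct_smul, smul_eq_mul]
  ring

/-- **The linear form (5.12.5)**: the interior vector `∂*σ_{k,loc}∂(I − Λ^{c*c}Q^{s*}Q)Λ^{c*}A = T_{mix}a − T_{in}Ra` that is paired
with `Λ^{(k)c*c}_{10}A^{(k)′}` in *"⟨Λ^{c*c}A′, ∂*σ_{k,loc}∂(I − Λ^{c*c}Q^{s*}Q)Λ^{c*}A⟩"*. [cite: BalabanImbrieJaffe1988, (5.12.5) p.301] -/
def linForm5125 (a : Out p → ℝ) : In p → ℝ :=
  blkMix p T *ᵥ a - blkIn p T *ᵥ (R *ᵥ a)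

/-- (5.12.5) read on the model: `⟨Λ^{c*c}A′, ∂*σ∂(I − R)Λ^{c*}A⟩ = ⟨a′, T_{mix}a⟩ − ⟨a′, T_{in}Ra⟩`.
[cite: BalabanImbrieJaffe1988, (5.12.5) p.301] -/
theorem eq5125_pairing (a' : In p → ℝ) (a : Out p → ℝ) :
    a' ⬝ᵥ linForm5125 p T R a = a' ⬝ᵥ (blkMix p T *ᵥ a) - a' ⬝ᵥ (blkIn p T *ᵥ (R *ᵥ a)) := by
  rw [linForm5125, dotProduct_sub]

/-- **p. 301, verbatim: *"We calculate (5.12.3) by means of a translation A^{(k)} = A^{(k)′} − Λ^{c*c}Q^{s*}QΛ^{c*}A^{(k)}, (5.12.4) …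
The fourth quadratic form above is obtained by collecting the terms in the exponential quadratic in Λ^{c*}A^{(k)}. There remains
a linear form ⟨Λ^{c*c}A^{(k)′}, ∂*σ_{k,loc}∂(I − Λ^{c*c}Q^{s*}Q)Λ^{c*}A^{(k)}⟩, (5.12.5)"*** — PROVED as the identity it is: for
symmetric `T`, substituting `a′ − Ra` for the interior variables in the exponent of (5.12.3) gives EXACTLY
`−½⟨a′, T_{in}a′⟩ − (5.12.5) + fourthForm(a)`. [cite: BalabanImbrieJaffe1988, (5.12.5) p.301] -/
theorem expo523_transl (hT : T.IsSymm) (a' : In p → ℝ) (a : Out p → ℝ) :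
    expo523 p T (a' - R *ᵥ a) a
      = -(1 / 2 : ℝ) * (a' ⬝ᵥ (blkIn p T *ᵥ a')) - a' ⬝ᵥ linForm5125 p T R a + fourthForm p T R a := by
  have hs : (blkIn p T).IsSymm := blkIn_isSymm p T hT
  have h1 : (R *ᵥ a) ⬝ᵥ (blkIn p T *ᵥ a') = a' ⬝ᵥ (blkIn p T *ᵥ (R *ᵥ a)) := by
    have h := dotProduct_transpose_mulVec (blkIn p T) a' (R *ᵥ a)
    rw [hs.eq] at h
    exact h.symm
  have h2 : a ⬝ᵥ (blkMix' p T *ᵥ a') = a' ⬝ᵥ (blkMix p T *ᵥ a) := by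
    rw [mix_dot_eq p T hT a' a]
    unfold srcJ
    exact dotProduct_comm _ _
  have h3 : a ⬝ᵥ (blkMix' p T *ᵥ (R *ᵥ a)) = (R *ᵥ a) ⬝ᵥ (blkMix p T *ᵥ a) := by
    rw [mix_dot_eq p T hT (R *ᵥ a) a]
    unfold srcJ
    exact dotProduct_comm _ _
  simp only [expo523, linForm5125, fourthForm, mulVec_sub, sub_dotProduct, dotProduct_sub]
  rw [h1, h2, h3]
  ring

/-! ### Free coordinates of the constraint subspace and the Gaussian calculation -/

variable {ι : Type} [Fintype ι] (E : Matrix (In p) ι ℝ)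

/-- The precision of the Gaussian `exp(−½⟨Λ^{c*c}A′, ∂*σ_{k,loc}∂Λ^{c*c}A′⟩)` in the free coordinates `x` of the constraint
subspace (`Λ^{c*c}A′ = Ex` after enforcing `δ_{Ax}`, `δ(QΛ^{c*c}A′)`; (4.8): *"the number of free integrations after enforcing the
δ-functions"*): `EᵀT_{in}E`. [cite: BalabanImbrieJaffe1988, (5.12.3) p.301] -/
def precK : Matrix ι ι ℝ := Eᵀ * blkIn p T * E

/-- **`C^{(k)}_{Λ^{(k)c*c}_{10}}`** of the fifth form: the covariance of the constrained Gaussian as an operator on interior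
configurations, `E(EᵀT_{in}E)⁻¹Eᵀ`. [cite: BalabanImbrieJaffe1988, (5.12.1) p.301] -/
def covK [DecidableEq ι] : Matrix (In p) (In p) ℝ := E * (precK p T E)⁻¹ * Eᵀ

/-- **`Z^{(k)}_{Λ^{(k)c*c}_{10}}`** of (5.12.1) in free coordinates (= (4.6) without its constants `(e_k/2π)^{‖Λ‖}`, `e^{−E‖Λ‖}`):
`∫dx e^{−½⟨Ex, T_{in}Ex⟩}`. [cite: BalabanImbrieJaffe1988, (5.12.1) p.301] -/
def Zgauge : ℝ := gaussNorm (precK p T E)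

/-- `Z_{Λ^{c*c}} > 0` when the precision on the constraint subspace is positive definite.
[cite: BalabanImbrieJaffe1988, (5.12.1) p.301] -/
theorem Zgauge_pos [DecidableEq ι] (hK : (precK p T E).PosDef) : 0 < Zgauge p T E :=
  gaussNorm_pos hK

/-- **The fifth form of (5.12.1)**, *"+½⟨Λ^{c*}A, (I − L^{−1}Q*Q^sΛ^{c*c})∂*σ_{k,loc}∂ C^{(k)}_{Λ^{c*c}} ∂*σ_{k,loc}∂(I − L^{−1}Λ^{c*c}Q^{s*}Q)
Λ^{c*}A⟩"* = `½⟨ℓ, C_{Λ^{c*c}}ℓ⟩` with `ℓ` the vector of (5.12.5). [cite: BalabanImbrieJaffe1988, (5.12.1) p.301] -/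
def fifthForm [DecidableEq ι] (a : Out p → ℝ) : ℝ :=
  (1 / 2 : ℝ) * (linForm5125 p T R a ⬝ᵥ (covK p T E *ᵥ linForm5125 p T R a))

/-- **(5.12.3) on the model**: the interior Gaussian integral with the `δ`-functions enforced — free coordinates `x`, interior
field `Ex − Ra` (the translation (5.12.4): `−Ra` is a particular solution of the block-average constraint,
`BIJ88LocTransl5126.eq5124_delta`), exterior field `a` fixed; the constant `(e_k/2π)^{‖Λ‖}` dropped.
[cite: BalabanImbrieJaffe1988, (5.12.3) p.301] -/
def constrInt523 (a : Out p → ℝ) : ℝ :=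
  ∫ x : ι → ℝ, Real.exp (expo523 p T (E *ᵥ x - R *ᵥ a) a)

/-- The model of (5.12.3) does not depend on WHICH particular solution of the constraints is subtracted: replacing `Ra` by
`Ra − Ex₀` (another point of the same affine constraint set) leaves the integral unchanged — translation invariance of `dx`.
[cite: BalabanImbrieJaffe1988, (5.12.4) p.301] -/
theorem constrInt523_indep (a : Out p → ℝ) (x₀ : ι → ℝ) :
    (∫ x : ι → ℝ, Real.exp (expo523 p T (E *ᵥ x - (R *ᵥ a - E *ᵥ x₀)) a)) = constrInt523 p T R E a := by
  have h : ∀ x : ι → ℝ, E *ᵥ x - (R *ᵥ a - E *ᵥ x₀) = E *ᵥ (x + x₀) - R *ᵥ a := by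
    intro x
    rw [mulVec_add]
    abel
  simp_rw [h]
  exact integral_add_right_eq_self (μ := (volume : Measure (ι → ℝ)))
    (fun x => Real.exp (expo523 p T (E *ᵥ x - R *ᵥ a) a)) x₀

/-- `⟨Ex, v⟩ = ⟨x, Eᵀv⟩`. [folklore] [cite: BalabanImbrieJaffe1988, (5.12.3) p.301] -/
private theorem dot_emb {m : Type} [Fintype m] (E : Matrix m ι ℝ) (x : ι → ℝ) (v : m → ℝ) :
    (E *ᵥ x) ⬝ᵥ v = x ⬝ᵥ (Eᵀ *ᵥ v) := by
  rw [dotProduct_transpose_mulVec]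
  exact dotProduct_comm _ _

/-- `⟨Ex, N Ex⟩ = ⟨x, (EᵀNE)x⟩`. [folklore] [cite: BalabanImbrieJaffe1988, (5.12.3) p.301] -/
private theorem quad_emb {m : Type} [Fintype m] (N : Matrix m m ℝ) (E : Matrix m ι ℝ) (x : ι → ℝ) :
    (E *ᵥ x) ⬝ᵥ (N *ᵥ (E *ᵥ x)) = x ⬝ᵥ ((Eᵀ * N * E) *ᵥ x) := by
  rw [dot_emb]
  simp only [mulVec_mulVec, Matrix.mul_assoc]

/-- A real positive definite matrix is symmetric. [folklore] [cite: BalabanImbrieJaffe1988, (5.12.3) p.301] -/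
private theorem isSymm_of_posDef {m : Type} [Fintype m] {M : Matrix m m ℝ} (hM : M.PosDef) : M.IsSymm := by
  have h := hM.isHermitian.eq
  rwa [conjTranspose_eq_transpose_of_trivial] at h

/-- In free coordinates the translated exponent is a tilted Gaussian exponent: `expo523(Ex − Ra, a) = (−⟨Eᵀℓ, x⟩ − ½⟨x, (EᵀT_{in}E)x⟩)
+ fourthForm(a)`, `ℓ` the vector of (5.12.5). [cite: BalabanImbrieJaffe1988, (5.12.5) p.301] -/
theorem expo523_freeCoords (hT : T.IsSymm) (a : Out p → ℝ) (x : ι → ℝ) :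
    expo523 p T (E *ᵥ x - R *ᵥ a) a
      = (-((Eᵀ *ᵥ linForm5125 p T R a) ⬝ᵥ x) - 1 / 2 * (x ⬝ᵥ (precK p T E *ᵥ x))) + fourthForm p T R a := by
  rw [expo523_transl p T R hT, quad_emb, dot_emb, dotProduct_comm x (Eᵀ *ᵥ linForm5125 p T R a), precK]
  ring

/-- **p. 301, verbatim: *"The 4-th and 5-th forms, with Z^{(k)}_{Λ^{(k)c*c}_{10}}, are a calculation of
∫dA^{(k)}|_{Λ^{c*c}_{10}} δ_{Ax,Λ′_{10}}(A^{(k)}) δ_{Λ′^{c*c}_{10}}(QA^{(k)}) (e_k/2π)^{‖Λ^{c*c}_{10}‖} exp[−½⟨Λ^{c*c}_{10}A^{(k)},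
∂*σ_{k,loc}∂(Λ^{c*c}_{10} + 2Λ^{c*}_{10})A^{(k)}⟩]. (5.12.3)"*** — PROVED on the model: for symmetric `T` with `EᵀT_{in}E` positive
definite, `(5.12.3) = Z_{Λ^{c*c}} · exp(fourthForm + fifthForm)` (the fourth form leaves the integral; the linear form (5.12.5)
is integrated out by the linear shift `B2Eq228Conditioning.integral_tilt`, producing the fifth form).
[cite: BalabanImbrieJaffe1988, (5.12.3) p.301] -/
theorem eq5123_calc [DecidableEq ι] (hT : T.IsSymm) (hK : (precK p T E).PosDef) (a : Out p → ℝ) :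
    constrInt523 p T R E a = Zgauge p T E * Real.exp (fourthForm p T R a + fifthForm p T R E a) := by
  have hKs : (precK p T E).IsSymm := isSymm_of_posDef hK
  have hdet : IsUnit (precK p T E).det := isUnit_iff_ne_zero.2 hK.det_pos.ne'
  unfold constrInt523
  simp_rw [expo523_freeCoords p T R E hT a, Real.exp_add]
  rw [integral_mul_const]
  have htilt := integral_tilt (precK p T E) hKs hdet (Eᵀ *ᵥ linForm5125 p T R a) (fun _ => (1 : ℝ))
  simp only [mul_one] at htilt
  rw [htilt, gaussInt_one_eq_gaussNorm]
  have e3 : (Eᵀ *ᵥ linForm5125 p T R a) ⬝ᵥ ((precK p T E)⁻¹ *ᵥ (Eᵀ *ᵥ linForm5125 p T R a))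
      = linForm5125 p T R a ⬝ᵥ (covK p T E *ᵥ linForm5125 p T R a) := by
    rw [covK, ← mulVec_mulVec, ← mulVec_mulVec, dotProduct_comm (linForm5125 p T R a), dot_emb]
    exact dotProduct_comm _ _
  rw [e3, Zgauge, fifthForm]
  ring

/-- **p. 301–302, verbatim: *"There remains a linear form ⟨Λ^{c*c}A^{(k)′}, ∂*σ_{k,loc}∂(I − Λ^{c*c}Q^{s*}Q)Λ^{c*}A^{(k)}⟩, (5.12.5)
whose expectation in the Gaussian exp(−½⟨Λ^{c*c}A^{(k)′}, ∂*σ_{k,loc}∂Λ^{c*c}A^{(k)′}⟩) gives rise to the fifth form"*** — PROVED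
on the model: the normalized Gaussian expectation (free coordinates, precision `EᵀT_{in}E` positive definite) of `e^{−(5.12.5)}` is
`e^{fifthForm}`. [cite: BalabanImbrieJaffe1988, (5.12.5) p.302] -/
theorem expect_linForm5125 [DecidableEq ι] (hK : (precK p T E).PosDef) (a : Out p → ℝ) :
    (Zgauge p T E)⁻¹ * ∫ x : ι → ℝ, gaussWeight (precK p T E) x * Real.exp (-((E *ᵥ x) ⬝ᵥ linForm5125 p T R a))
      = Real.exp (fifthForm p T R E a) := by
  have hKs : (precK p T E).IsSymm := isSymm_of_posDef hK
  have hdet : IsUnit (precK p T E).det := isUnit_iff_ne_zero.2 hK.det_pos.ne'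
  have hZ : gaussNorm (precK p T E) ≠ 0 := (gaussNorm_pos hK).ne'
  have hpt : ∀ x : ι → ℝ, gaussWeight (precK p T E) x * Real.exp (-((E *ᵥ x) ⬝ᵥ linForm5125 p T R a))
      = Real.exp (-((Eᵀ *ᵥ linForm5125 p T R a) ⬝ᵥ x) - 1 / 2 * (x ⬝ᵥ (precK p T E *ᵥ x))) := by
    intro x
    rw [gaussWeight, ← Real.exp_add, dot_emb, dotProduct_comm x (Eᵀ *ᵥ linForm5125 p T R a)]
    congr 1
    ring
  have htilt := integral_tilt (precK p T E) hKs hdet (Eᵀ *ᵥ linForm5125 p T R a) (fun _ => (1 : ℝ))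
  simp only [mul_one] at htilt
  simp_rw [hpt]
  rw [htilt, gaussInt_one_eq_gaussNorm]
  have e3 : (Eᵀ *ᵥ linForm5125 p T R a) ⬝ᵥ ((precK p T E)⁻¹ *ᵥ (Eᵀ *ᵥ linForm5125 p T R a))
      = linForm5125 p T R a ⬝ᵥ (covK p T E *ᵥ linForm5125 p T R a) := by
    rw [covK, ← mulVec_mulVec, ← mulVec_mulVec, dotProduct_comm (linForm5125 p T R a), dot_emb]
    exact dotProduct_comm _ _
  rw [e3, Zgauge, fifthForm, ← mul_assoc, mul_comm (gaussNorm (precK p T E))⁻¹, mul_assoc, inv_mul_cancel₀ hZ, mul_one]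

end Gauge

/-! ## §4 (v1.1) p. 302: `𝒬₇`, `𝒬₈` and `W₅^{(k)}(X)` — the exponential of (5.12.1) regrouped

p. 302 [PDF 46], verbatim: *"We remove the nonlocality in the third and fifth quadratic forms with random walk expansions for
C^{(k)}_{Λ^{(k)}_{10}}(u_{k+1}) and for C^{(k)}_{Λ^{(k)c*c}_{10}} as in (2.45) and (2.48). These obey the usual estimates. We denote the
first and second quadratic forms by 𝒬₇, and the other three [with C^{(k)}_{Λ^{(k)}_{10}}(u_{k+1}), C^{(k)}_{Λ^{(k)c*c}_{10}} replaced with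
C^{(k)}_{Λ^{(k)}_{10},loc}(u_{k+1}), C^{(k)}_{Λ^{(k)c*c}_{10},loc}] by 𝒬₈. Altogether the exponential in (5.12.1) has been written as
exp[−𝒬₇ − 𝒬₈ − Σ_X W₅^{(k)}(X)]. Here W₅^{(k)}(X) contains the terms with C^{(k)}_{Λ^{(k)}_{10},X}(u_{k+1}) or with C^{(k)}_{Λ^{(k)c*c}_{10},X},
and satisfies |W₅^{(k)}(X)| ≦ e^{−cr(e_k)|X|}."*  Model: the random-walk expansions (2.45)/(2.48) are DATA — finite decompositions
`C = C_loc + Σ_{X∈𝒳} C_X` of the two covariances as matrices; the third and fifth forms are LINEAR in the covariance, so the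
regrouping is an identity.  The bound `|W₅(X)| ≤ e^{−cr|X|}` is NOT claimed. -/

section Regroup

/-- `½⟨v, Cv⟩` — the third form (`v = ΔΛᶜφ`, `C = C_{Λ_{10}}(u_{k+1})`) and the fifth form (`v` = the vector of (5.12.5),
`C = C_{Λ^{c*c}}`) as functions of the covariance. [cite: BalabanImbrieJaffe1988, (5.12.1) p.302] -/
def halfQuad {m : Type} [Fintype m] (C : Matrix m m ℝ) (v : m → ℝ) : ℝ := (1 / 2 : ℝ) * (v ⬝ᵥ (C *ᵥ v))

/-- The third form of (5.12.1) is `halfQuad` at `C = C_{Λ_{10}}(u_{k+1}) = (blkIn (Δ+P))⁻¹`, `v = Λ_{10}ΔΛ^c_{10}φ`.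
[cite: BalabanImbrieJaffe1988, (5.12.1) p.302] -/
theorem thirdForm_eq_halfQuad [DecidableEq S] (Δ M : Matrix S S ℝ) (y : Out p → ℝ) :
    thirdForm p Δ M y = halfQuad ((blkIn p M)⁻¹) (blkMix p Δ *ᵥ y) := rfl

/-- The fifth form of (5.12.1) is `halfQuad` at `C = C_{Λ^{c*c}} = covK`, `v` = the vector of (5.12.5).
[cite: BalabanImbrieJaffe1988, (5.12.1) p.302] -/
theorem fifthForm_eq_halfQuad {ι : Type} [Fintype ι] [DecidableEq ι] (T : Matrix S S ℝ) (R : Matrix (In p) (Out p) ℝ)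
    (E : Matrix (In p) ι ℝ) (a : Out p → ℝ) :
    fifthForm p T R E a = halfQuad (covK p T E) (linForm5125 p T R a) := rfl

/-- Linearity in the covariance: `(Σ_X C_X)v = Σ_X C_Xv`. [folklore] [cite: BalabanImbrieJaffe1988, (2.45) p.264] -/
private theorem sum_mulVec' {m J : Type} [Fintype m] (s : Finset J) (C : J → Matrix m m ℝ) (v : m → ℝ) :
    (∑ X ∈ s, C X) *ᵥ v = ∑ X ∈ s, C X *ᵥ v := by
  exact map_sum (mulVec.addMonoidHomLeft v) C s

/-- **The third/fifth form under a random-walk decomposition of its covariance** (print: (2.45), (2.48)):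
`½⟨v, (C_loc + Σ_X C_X)v⟩ = ½⟨v, C_loc v⟩ + Σ_X ½⟨v, C_X v⟩`. [cite: BalabanImbrieJaffe1988, (5.12.1) p.302] -/
theorem halfQuad_decomp {m J : Type} [Fintype m] (s : Finset J) (Cloc : Matrix m m ℝ) (CX : J → Matrix m m ℝ) (v : m → ℝ) :
    halfQuad (Cloc + ∑ X ∈ s, CX X) v = halfQuad Cloc v + ∑ X ∈ s, halfQuad (CX X) v := by
  unfold halfQuad
  rw [add_mulVec, sum_mulVec', dotProduct_add, dotProduct_sum, mul_add, Finset.mul_sum]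

/-- **𝒬₈** of p. 302: the third, fourth and fifth forms of (5.12.1) with the covariances replaced by their LOCAL parts
`C_{Λ_{10},loc}(u_{k+1})`, `C_{Λ^{c*c},loc}` (sign: the exponential is `exp[−𝒬₇ − 𝒬₈ − …]`, the third and fifth forms enter (5.12.1) with
`+`, the fourth with its own sign). [cite: BalabanImbrieJaffe1988, (5.12.1) p.302] -/
def Q8 {mφ mA : Type} [Fintype mφ] [Fintype mA] (CφLoc : Matrix mφ mφ ℝ) (CALoc : Matrix mA mA ℝ) (vφ : mφ → ℝ)
    (vA : mA → ℝ) (fourth : ℝ) : ℝ :=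
  -(halfQuad CφLoc vφ + fourth + halfQuad CALoc vA)

/-- **W₅^{(k)}(X)** of p. 302: *"the terms with C_{Λ_{10},X}(u_{k+1}) or with C_{Λ^{c*c},X}"* — minus the `X`-parts of the third
and fifth forms. [cite: BalabanImbrieJaffe1988, (5.12.1) p.302] -/
def W5 {mφ mA J : Type} [Fintype mφ] [Fintype mA] (CφX : J → Matrix mφ mφ ℝ) (CAX : J → Matrix mA mA ℝ) (vφ : mφ → ℝ)
    (vA : mA → ℝ) (X : J) : ℝ :=
  -(halfQuad (CφX X) vφ + halfQuad (CAX X) vA)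

/-- **p. 302, verbatim: *"Altogether the exponential in (5.12.1) has been written as exp[−𝒬₇ − 𝒬₈ − Σ_X W₅^{(k)}(X)]"*** — PROVED as
the regrouping it is: with `𝒬₇ := q₁ + q₂` (the first and second forms), the exponent of (5.12.1)
`−q₁ − q₂ + ½⟨v_φ, C_φ v_φ⟩ + (fourth form) + ½⟨v_A, C_A v_A⟩` EQUALS `−𝒬₇ − 𝒬₈ − Σ_{X∈𝒳} W₅(X)` whenever
`C_φ = C_{φ,loc} + Σ_X C_{φ,X}` and `C_A = C_{A,loc} + Σ_X C_{A,X}` (the random-walk expansions (2.45), (2.48), taken as data over one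
finite index set `𝒳` of connected unions of cubes). [cite: BalabanImbrieJaffe1988, (5.12.1) p.302] -/
theorem exponent5121_regroup {mφ mA J : Type} [Fintype mφ] [Fintype mA] (s : Finset J) (q₁ q₂ fourth : ℝ)
    (CφLoc : Matrix mφ mφ ℝ) (CφX : J → Matrix mφ mφ ℝ) (CALoc : Matrix mA mA ℝ) (CAX : J → Matrix mA mA ℝ)
    (vφ : mφ → ℝ) (vA : mA → ℝ) :
    -q₁ - q₂ + halfQuad (CφLoc + ∑ X ∈ s, CφX X) vφ + fourth + halfQuad (CALoc + ∑ X ∈ s, CAX X) vA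
      = -(q₁ + q₂) - Q8 CφLoc CALoc vφ vA fourth - ∑ X ∈ s, W5 CφX CAX vφ vA X := by
  rw [halfQuad_decomp, halfQuad_decomp]
  simp only [Q8, W5, Finset.sum_neg_distrib, Finset.sum_add_distrib]
  ring

/-- The same with the exponentials: `exp[exponent of (5.12.1)] = exp[−𝒬₇]·exp[−𝒬₈]·exp[−Σ_X W₅(X)]`.
[cite: BalabanImbrieJaffe1988, (5.12.1) p.302] -/
theorem exp_exponent5121_regroup {mφ mA J : Type} [Fintype mφ] [Fintype mA] (s : Finset J) (q₁ q₂ fourth : ℝ)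
    (CφLoc : Matrix mφ mφ ℝ) (CφX : J → Matrix mφ mφ ℝ) (CALoc : Matrix mA mA ℝ) (CAX : J → Matrix mA mA ℝ)
    (vφ : mφ → ℝ) (vA : mA → ℝ) :
    Real.exp (-q₁ - q₂ + halfQuad (CφLoc + ∑ X ∈ s, CφX X) vφ + fourth + halfQuad (CALoc + ∑ X ∈ s, CAX X) vA)
      = Real.exp (-(q₁ + q₂)) * Real.exp (-Q8 CφLoc CALoc vφ vA fourth) * Real.exp (-∑ X ∈ s, W5 CφX CAX vφ vA X) := by
  rw [exponent5121_regroup, ← Real.exp_add, ← Real.exp_add]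
  exact congrArg Real.exp (by ring)

end Regroup

end

end Literature.MathematicalPhysics.QuantumFieldTheory.BalabanImbrieJaffe1984to88.BIJ88ExteriorForms5121
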